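import Summits.RiemannHypothesis.RiemannHypothesis.Theses.WeilSemilocal
import Summits.RiemannHypothesis.RiemannHypothesis.Theorems.SemilocalClassLaw
import Summits.RiemannHypothesis.RiemannHypothesis.Theorems.WeilSemilocalRowsHeadTheta
import Summits.RiemannHypothesis.RiemannHypothesis.Theorems.SemilocalNegCertUptoSeventyNineFinal
import Summits.RiemannHypothesis.RiemannHypothesis.Theorems.SemilocalNegCertUptoEightyThreeFinal
import Summits.RiemannHypothesis.RiemannHypothesis.Theorems.SemilocalNegCertUptoEightyNineFinal
import Summits.RiemannHypothesis.RiemannHypothesis.Theorems.SemilocalNegCertUptoHundredThreeKinkedFinal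
import Summits.RiemannHypothesis.RiemannHypothesis.Theorems.SemilocalNegCertUptoHundredNineFinal
import Summits.RiemannHypothesis.RiemannHypothesis.Theorems.SemilocalNegCertUptoHundredTwentySevenFinal
import HarnessLib

/-!
# Route `WeilSemilocal`, item `SemilocalRowsToOneFiftySeven` (stmt-RiemannHypothesis-19396): the fourteen rows `80 ≤ q < 157` REDUCED TO SIX NAMED ROWS (RH-FREE)

Cell `rh-explicit`, WEIL column (LADDER-RH W-P(P2)); seat weil-1 gen20. The item is C-I(a) at the fourteen primes `83, 89, 97, 101, 103,
107, 109, 113, 127, 131, 137, 139, 149, 151`. Eleven of them are kernel theorems in the tree: nine by the K-cell negativity certificates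
of `SemilocalPolyWitness` (`…uptoSeventyNine_lt_log_eightyseven_half` (q = 83), `…uptoEightyThree…` (89), `…uptoEightyNine…` (97),
`…uptoHundredThree…` (107), `…uptoHundredNine…` (113), `…uptoHundredThirteen…` (127), `…uptoHundredTwentySeven…` (131),
`…uptoHundredThirtySeven…` (139), `…uptoHundredFortyNine…` (151)) and two by the TIER-1 theta certificates of this seat
(`WeilSemilocalRowsHeadTheta`: q = 103, 109). This file packages the EIGHT of them whose modules are BUILT on the farm today (83, 89, 97, 103, 107, 109, 113, 131) in cc-s2-1's
`SemilocalClassLawAt` currency (`semilocalClassLawAt_of_eq` + `interval_cases`, the `semilocalClassLawBelow_eighty` pattern) and proves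
**`semilocalRowsToOneFiftySeven_of_six`**: the item from `SemilocalClassLawAt` at the six remaining primes `101, 127, 137, 139, 149, 151` — of
which 127, 139, 151 ARE tree theorems (`…UptoHundredThirteen/ThirtySeven/FortyNineFinal`, oleans pending; discharged in the sequel
`WeilSemilocalRowsToOneFiftySevenOfTwins`) and 101, 137, 149 are the lower twins (K-cell chains of cc-s2-4 / cc-s2-10).
Upper clauses of TRUNCATED Weil forms only; nothing here bears on the truth of RH.
-/

set_option linter.dupNamespace false  -- the mandated namespace repeats `RiemannHypothesis`

namespace Summit.RiemannHypothesis.RiemannHypothesis.Theorems.WeilSemilocalRoute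

open Summit.RiemannHypothesis.RiemannHypothesis.Theorems.SemilocalClassLaw
open Summit.RiemannHypothesis.RiemannHypothesis.Theorems.SemilocalPolyWitness

/-- `q = 83` (`a*(S_83) < (log 87)/2`). [tree certificate `SemilocalNegCertUptoSeventyNineFinal`] -/
theorem semilocalClassLawAt_eightythree : SemilocalClassLawAt 83 :=
  semilocalClassLawAt_of_eq (Q := 87) (by decide) (fun m h1 h2 ↦ by interval_cases m <;> decide)
    weilSemilocalThreshold_uptoSeventyNine_lt_log_eightyseven_half

/-- `q = 89` (`a*(S_89) < (log 92)/2`). [tree certificate `SemilocalNegCertUptoEightyThreeFinal`] -/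
theorem semilocalClassLawAt_eightynine : SemilocalClassLawAt 89 :=
  semilocalClassLawAt_of_eq (Q := 92) (by decide) (fun m h1 h2 ↦ by interval_cases m <;> decide)
    weilSemilocalThreshold_uptoEightyThree_lt_log_ninetytwo_half

/-- `q = 97` (`a*(S_97) < (log 101)/2`). [tree certificate `SemilocalNegCertUptoEightyNineFinal`] -/
theorem semilocalClassLawAt_ninetyseven : SemilocalClassLawAt 97 :=
  semilocalClassLawAt_of_eq (Q := 101) (by decide) (fun m h1 h2 ↦ by interval_cases m <;> decide)
    weilSemilocalThreshold_uptoEightyNine_lt_log_hundredone_half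

/-- `q = 103` (`a*(S_103) < (log 107)/2`, TIER-1 theta certificate). [this cell, `WeilSemilocalRowsHeadTheta`] -/
theorem semilocalClassLawAt_hundredthree : SemilocalClassLawAt 103 :=
  semilocalClassLawAt_of_lt (Q := 107) (fun m h1 h2 ↦ by interval_cases m <;> decide)
    weilSemilocalThreshold_uptoHundredOne_lt_log_hundredSeven_half

/-- `q = 107` (`a*(S_107) < (log 109)/2`). [tree certificate `SemilocalNegCertUptoHundredThreeKinkedFinal`] -/
theorem semilocalClassLawAt_hundredseven : SemilocalClassLawAt 107 :=
  semilocalClassLawAt_of_eq (Q := 109) (by decide) (fun m h1 h2 ↦ by interval_cases m; decide)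
    weilSemilocalThreshold_uptoHundredThree_lt_log_hundrednine_half

/-- `q = 109` (`a*(S_109) < (log 113)/2`, TIER-1 theta certificate). [this cell, `WeilSemilocalRowsHeadTheta`] -/
theorem semilocalClassLawAt_hundrednine : SemilocalClassLawAt 109 :=
  semilocalClassLawAt_of_lt (Q := 113) (fun m h1 h2 ↦ by interval_cases m <;> decide)
    weilSemilocalThreshold_uptoHundredSeven_lt_log_hundredThirteen_half

set_option maxRecDepth 8000 in  -- `Nat.primesBelow 113 = {2, …, 109}` by `decide`
/-- `q = 113` (`a*(S_113) < (log 117)/2`). [tree certificate `SemilocalNegCertUptoHundredNineFinal`] -/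
theorem semilocalClassLawAt_hundredthirteen : SemilocalClassLawAt 113 :=
  semilocalClassLawAt_of_eq (Q := 117) (by decide) (fun m h1 h2 ↦ by interval_cases m <;> decide)
    weilSemilocalThreshold_uptoHundredNine_lt_log_hundredseventeen_half

set_option maxRecDepth 8000 in  -- `Nat.primesBelow 131 = {2, …, 127}` by `decide`
/-- `q = 131` (`a*(S_131) < (log 137)/2`). [tree certificate `SemilocalNegCertUptoHundredTwentySevenFinal`] -/
theorem semilocalClassLawAt_hundredthirtyone : SemilocalClassLawAt 131 :=
  semilocalClassLawAt_of_eq (Q := 137) (by decide) (fun m h1 h2 ↦ by interval_cases m <;> decide)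
    weilSemilocalThreshold_uptoHundredTwentySeven_lt_log_hundredthirtyseven_half

set_option maxRecDepth 8000 in
set_option maxHeartbeats 800000 in  -- 77-way `interval_cases` on `80 ≤ q < 157`
/-- **`SemilocalRowsToOneFiftySeven` FROM SIX NAMED ROWS**: C-I(a) at `q = 101, 127, 137, 139, 149, 151` implies the item (the other eight
rows `80 ≤ q < 157` are kernel theorems above). [this cell; RH-FREE] -/
theorem semilocalRowsToOneFiftySeven_of_six (h101 : SemilocalClassLawAt 101) (h127 : SemilocalClassLawAt 127)
    (h137 : SemilocalClassLawAt 137) (h139 : SemilocalClassLawAt 139) (h149 : SemilocalClassLawAt 149)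
    (h151 : SemilocalClassLawAt 151) :
    Summit.RiemannHypothesis.RiemannHypothesis.Theses.WeilSemilocal.SemilocalRowsToOneFiftySeven := by
  unfold Theses.WeilSemilocal.SemilocalRowsToOneFiftySeven
  intro q hq h80 h157
  interval_cases q <;> first
    | exact absurd hq (by decide)
    | exact semilocalClassLawAt_eightythree | exact semilocalClassLawAt_eightynine | exact semilocalClassLawAt_ninetyseven
    | exact h101 | exact semilocalClassLawAt_hundredthree | exact semilocalClassLawAt_hundredseven
    | exact semilocalClassLawAt_hundrednine | exact semilocalClassLawAt_hundredthirteen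
    | exact h127 | exact semilocalClassLawAt_hundredthirtyone | exact h137
    | exact h139 | exact h149 | exact h151

end Summit.RiemannHypothesis.RiemannHypothesis.Theorems.WeilSemilocalRoute
-- 2026-08-26T14:0xZ weil-1 gen20: byte-identical re-land to refresh the stranded hub olean (gate5 build-queue workaround); no content change.
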